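import Mathlib
import Literature.Probability.LatticeModels.TwoPointSupNormMonotone
import Literature.Probability.LatticeModels.CriticalTwoPointBounds
import Literature.Probability.LatticeModels.HighDimPointwiseTriviality
import Summits.CriticalPhenomena.Ising3DConformalLimit.Theses.MirrorHoelderCompactness
import HarnessLib

/-!
# Two-point comparisons at `β_c(3)` under all-scale doubling
(helper file for item stmt-CriticalPhenomena-6158, `CompactnessGlue`, route `MirrorHoelderCompactness`)

Write `G(z) = ⟨σ₀σ_z⟩⁺_{β_c(3)}` (`criticalTwoPoint 3 z`) and `g(n) = G(n e₀)`. This file collects the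
lattice two-point inequalities that the local bounds (parts (a) and (c) of `UniformRegularity`, i.e.
the content of the support item `RescaledBounds`) consume:

* `criticalTwoPoint_axis_antitone` — `g` is non-increasing on `ℕ` (Messager–Miracle-Solé along the
  axis, `twoPointPlus_add_single_le` with `messager_miracleSole_holds`);
* `criticalTwoPoint_sandwich` — `g(3‖z‖_∞) ≤ G(z) ≤ g(‖z‖_∞)` (the two halves of Duminil-Copin's
  eq. (4.10), `twoPointPlus_le_of_mul_supNorm_le` / `twoPointPlus_le_axis_of_mem_sphere`);
* `doubling_iterate` — from `TwoPointDoubling` (`κ g(n) ≤ g(2n)`): `κᵏ g(n) ≤ g(2ᵏ n)`;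
* `criticalTwoPoint_axis_comparable` — from `TwoPointDoubling`: for every `L` there is `C > 0` with
  `g(n) ≤ C g(n')` whenever `1 ≤ n` and `n' ≤ L n` (doubling `k` times with `2ᵏ ≥ L`, then
  monotonicity).

References: A. Messager, S. Miracle-Solé, J. Stat. Phys. 17 (1977) 245; M. Aizenman,
H. Duminil-Copin, Ann. of Math. 194 (2021), §5.1 eq. (5.3); H. Duminil-Copin, *Lectures on the Ising
and Potts models on the hypercubic lattice* (2019), eq. (4.10). No definitions are introduced.
-/

noncomputable section

namespace Summit.CriticalPhenomena.Ising3DConformalLimit.MirrorHoelderCompactnessGlue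

open Literature.Probability.LatticeModels
open Summit.CriticalPhenomena.Ising3DConformalLimit.Theses.MirrorHoelderCompactness

/-- The supremum norm of the axis site `n e₀` is at least `n`. [folklore] -/
theorem le_supNorm_single (n : ℕ) : n ≤ Site.supNorm (Pi.single (0 : Fin 3) (n : ℤ) : Site 3) := by
  have h := Site.natAbs_le_supNorm (Pi.single (0 : Fin 3) (n : ℤ) : Site 3) 0
  simpa using h

/-- **Messager–Miracle-Solé along the axis**: `n ↦ g(n) = ⟨σ₀σ_{n e₀}⟩_{β_c}` is non-increasing
on `ℕ`. [cite: MessagerMiracleSoleJSP1977, main theorem (monotonicity of ⟨σ₀σ_x⟩ under reflections)] -/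
theorem criticalTwoPoint_axis_antitone {a b : ℕ} (hab : a ≤ b) :
    criticalTwoPoint 3 (Pi.single 0 (b : ℤ)) ≤ criticalTwoPoint 3 (Pi.single 0 (a : ℤ)) := by
  have key := twoPointPlus_add_single_le
    (messager_miracleSole_holds (d := 3) (β := criticalBeta 3)) (criticalBeta_nonneg 3)
    (Pi.single (0 : Fin 3) (a : ℤ)) 0 (by simp) (b - a)
  have h : (a : ℤ) + ((b - a : ℕ) : ℤ) = (b : ℤ) := by omega
  rw [← Pi.single_add, h] at key
  exact key

/-- **Sup-norm sandwich** (the two halves of Duminil-Copin 2019, eq. (4.10), at `β_c(3)`):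
`g(3‖z‖_∞) ≤ G(z) ≤ g(‖z‖_∞)`. [cite: DuminilCopin2019, Exercise 37 (4), eq. (4.10), §4.3] -/
theorem criticalTwoPoint_sandwich (z : Site 3) :
    criticalTwoPoint 3 (Pi.single 0 ((3 * Site.supNorm z : ℕ) : ℤ)) ≤ criticalTwoPoint 3 z ∧
      criticalTwoPoint 3 z ≤ criticalTwoPoint 3 (Pi.single 0 (Site.supNorm z : ℤ)) := by
  constructor
  · exact twoPointPlus_le_of_mul_supNorm_le (d := 3) (criticalBeta_nonneg 3)
      (le_supNorm_single (3 * Site.supNorm z))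
  · have hMMS : ∀ {β : ℝ}, messager_miracleSole (d := 3) (β := β) := fun {β} =>
      messager_miracleSole_holds (d := 3) (β := β)
    have h := twoPointPlus_le_axis_of_mem_sphere hMMS twoPointPlus_reflection_invariant_holds
      twoPointPlus_perm_invariant_holds (criticalBeta_nonneg 3) (show 1 ≤ 3 by norm_num)
      (self_mem_sphere z)
    exact h

/-- **Iterated doubling**: under `TwoPointDoubling` (`κ g(n) ≤ g(2n)` for `n ≥ 1`),
`κᵏ g(n) ≤ g(2ᵏ n)` for all `k` and `n ≥ 1`. [folklore] -/
theorem doubling_iterate (hD : TwoPointDoubling) :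
    ∃ κ : ℝ, 0 < κ ∧ ∀ k n : ℕ, 1 ≤ n →
      κ ^ k * criticalTwoPoint 3 (Pi.single 0 (n : ℤ)) ≤
        criticalTwoPoint 3 (Pi.single 0 ((2 ^ k * n : ℕ) : ℤ)) := by
  obtain ⟨κ, hκ, h⟩ := hD
  refine ⟨κ, hκ, fun k => ?_⟩
  induction k with
  | zero =>
      intro n _
      simp
  | succ k ih =>
      intro n hn
      have h1 := ih n hn
      have h2 := h (2 ^ k * n) (le_trans hn (Nat.le_mul_of_pos_left n (Nat.two_pow_pos k)))
      have hcast : (2 : ℤ) * ((2 ^ k * n : ℕ) : ℤ) = ((2 ^ (k + 1) * n : ℕ) : ℤ) := by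
        push_cast
        ring
      rw [hcast] at h2
      calc κ ^ (k + 1) * criticalTwoPoint 3 (Pi.single 0 (n : ℤ))
          = κ * (κ ^ k * criticalTwoPoint 3 (Pi.single 0 (n : ℤ))) := by ring
        _ ≤ κ * criticalTwoPoint 3 (Pi.single 0 ((2 ^ k * n : ℕ) : ℤ)) :=
            mul_le_mul_of_nonneg_left h1 hκ.le
        _ ≤ criticalTwoPoint 3 (Pi.single 0 ((2 ^ (k + 1) * n : ℕ) : ℤ)) := h2

/-- **Comparable scales**: under `TwoPointDoubling`, for every `L` there is `C > 0` with
`g(n) ≤ C g(n')` whenever `1 ≤ n` and `n' ≤ L n` (`κ^L g(n) ≤ g(2^L n) ≤ g(n')` since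
`n' ≤ L n ≤ 2^L n` and `g` is non-increasing). [folklore] -/
theorem criticalTwoPoint_axis_comparable (hD : TwoPointDoubling) (L : ℕ) :
    ∃ C : ℝ, 0 < C ∧ ∀ n n' : ℕ, 1 ≤ n → n' ≤ L * n →
      criticalTwoPoint 3 (Pi.single 0 (n : ℤ)) ≤ C * criticalTwoPoint 3 (Pi.single 0 (n' : ℤ)) := by
  obtain ⟨κ, hκ, hiter⟩ := doubling_iterate hD
  have hpow : 0 < κ ^ L := pow_pos hκ L
  refine ⟨(κ ^ L)⁻¹, inv_pos.2 hpow, fun n n' hn hn' => ?_⟩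
  have h1 := hiter L n hn
  have hL : L ≤ 2 ^ L := (Nat.lt_two_pow_self).le
  have h2 : n' ≤ 2 ^ L * n := hn'.trans (Nat.mul_le_mul_right n hL)
  have h3 := criticalTwoPoint_axis_antitone h2
  rw [le_inv_mul_iff₀ hpow]
  exact h1.trans h3

end Summit.CriticalPhenomena.Ising3DConformalLimit.MirrorHoelderCompactnessGlue

end
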